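import Literature.MathematicalPhysics.QuantumLattice.FermionOperatorsProofs
import HarnessLib

/-!
# Pseudospin (Yang `η`-SU(2)) covariance of the singlet bond pair field — Zhang 1990, Markiewicz–Vaughn 1998 (reproduction)

Trunk T-QLATTICE, family `hubbard`. Literature REPRODUCTION with citation header; sibling proof
file of `Literature/MathematicalPhysics/QuantumLattice/FermionOperators.lean`, built only on the
CAR algebra of `FermionOperatorsProofs.lean` (`hopTerm_commutator_etaRaise`,
`annihilation_anticommute_holds`, `annihilation_conjTranspose`); no existing statement is changed.

**What is reproduced.** S.-C. Zhang, *Pseudospin symmetry and new collective modes of the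
Hubbard model*, Phys. Rev. Lett. **65** (1990) 120–122, observed that under Yang's pseudospin
`η_ε^- = Σ_z ε_z c_{z↓} c_{z↑}` (`ε_z = ±1` a staggered sign, `etaLower`) the singlet pair
operator on a bond and the bond current do not transform as scalars but sit in one pseudospin
TRIPLET; R. S. Markiewicz, M. T. Vaughn, *Stripes, pseudogaps, and SO(6) in the cuprate
superconductors*, J. Phys. Chem. Solids **59** (1998) 1737–1741 (arXiv:cond-mat/9709137), p. 3,
state it for the d-wave form factor: "a pseudospin triplet combining d-wave superconductivity
(`Δ_d`, `Δ_d†`) and an orbital antiferromagnet (`O_JC`) equivalent to the flux phase operator".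
The on-site (`s`-wave) analogue is C. N. Yang, PRL **63** (1989) 2144, eq. (6) and T. Xiang,
C. Wu, *D-wave Superconductivity* (CUP 2022), eqs. (13.51)–(13.52).

Proved here, for every finite `Λ`, every sign `ε : Λ → ℤˣ`, all sites `x y : Λ`:

* `hopTerm_commutator_etaLower` — the adjoint of `hopTerm_commutator_etaRaise`:
  `[η_ε^-, c†_{yσ} c_{xσ}] = ε_y · (c_{y↓} c_{x↑}` resp. `-c_{y↑} c_{x↓})`;
* `spinSummedHop_commutator_etaLower` — summed over spin,
  `[η_ε^-, Σ_σ c†_{yσ} c_{xσ}] = -ε_y · d_{xy}` with the singlet bond pair annihilator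
  `d_{xy} = c_{x↑} c_{y↓} - c_{x↓} c_{y↑}` (`bondPairAnn`);
* `bondPairAnn_symm` — `d_{yx} = d_{xy}`;
* `etaLower_commutator_bondCurrent` — for a bond joining opposite signs (`ε_y = -ε_x`, i.e. a
  bond of a bipartite lattice with the staggered sign), the spin-summed antisymmetric bond current
  `j_{xy} = Σ_σ (c†_{xσ} c_{yσ} - c†_{yσ} c_{xσ})` (`bondCurrent`) obeys
  `[η_ε^-, j_{xy}] = -2 ε_x · d_{xy}` — the triplet's lowering step (current ↦ pair);
* `etaLower_commute_bondPairAnn` — `[η_ε^-, d_{xy}] = 0` (the pair annihilator is the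
  lowest component).

* `etaLower_commutator_weightedCurrent`, `etaLower_commute_weightedPair` — summed against an
  arbitrary finite family of bonds `b i = (x_i, y_i)` with weights `w i : ℂ` (e.g. a `d_{x²-y²}`
  form factor) and `ε_{y_i} = -ε_{x_i}`: Zhang's triplet relation `[η^-, J_w] = -2 Δ_w` between the
  staggered weighted current `J_w = Σ_i w_i ε_{x_i} j_{x_i y_i}` and the weighted pair field
  `Δ_w = Σ_i w_i d_{x_i y_i}`, and `[η^-, Δ_w] = 0`.

The identification of `Δ_w` with `PairCorrelations.pairField` on the torus and the pseudospin
selection rules these relations imply for pair correlations in `η`-lowest-weight states are NOT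
part of this file.

## Sources

S.-C. Zhang, PRL **65** (1990) 120, [cite: Zhang1990]; R. S. Markiewicz, M. T. Vaughn, J. Phys.
Chem. Solids **59** (1998) 1737, p. 3 [cite: MarkiewiczVaughn1998, p. 3]; C. N. Yang, PRL **63**
(1989) 2144, eq. (6) [cite: Yang1989, eq. (6)].
-/

namespace Literature.MathematicalPhysics.QuantumLattice

open Matrix Finset HubbardWave0

section Hubbard

variable {Λ : Type*} [LinearOrder Λ] [Fintype Λ]

/-- The singlet pair annihilator on the ordered bond `(x, y)`:
`d_{xy} = c_{x↑} c_{y↓} - c_{x↓} c_{y↑}` (the summand of `PairCorrelations.localPair`, up to the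
form factor). Markiewicz–Vaughn (1998) p. 3 (`Δ_d`). [cite: MarkiewiczVaughn1998, p. 3] -/
noncomputable def bondPairAnn (x y : Λ) : Matrix (Finset (Orb Λ)) (Finset (Orb Λ)) ℂ :=
  annihilation (orb x 0) * annihilation (orb y 1) - annihilation (orb x 1) * annihilation (orb y 0)

/-- The spin-summed antisymmetric bond current (without the factor `i`):
`j_{xy} = Σ_σ (c†_{xσ} c_{yσ} - c†_{yσ} c_{xσ})`; with the staggered sign this is the orbital
antiferromagnet / flux-phase operator `O_JC` of Markiewicz–Vaughn (1998) p. 3.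
[cite: MarkiewiczVaughn1998, p. 3] -/
noncomputable def bondCurrent (x y : Λ) : Matrix (Finset (Orb Λ)) (Finset (Orb Λ)) ℂ :=
  ∑ σ : Fin 2, (creation (orb x σ) * annihilation (orb y σ) - creation (orb y σ) * annihilation (orb x σ))

/-- CAR: `c_i c_j = - c_j c_i`. [folklore] -/
theorem annihilation_mul_annihilation_eq_neg (i j : Orb Λ) :
    annihilation i * annihilation j = -(annihilation j * annihilation i) :=
  eq_neg_of_add_eq_zero_left (annihilation_anticommute_holds i j)

/-- Adjoint of `hopTerm_commutator_etaRaise`: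
`η^- (c†_{yσ} c_{xσ}) - (c†_{yσ} c_{xσ}) η^- = ε_y · (c_{y↓} c_{x↑})` for `σ = ↑` and
`= -ε_y · (c_{y↑} c_{x↓})` for `σ = ↓`. Yang (1989) eq. (6) (on-site case); Zhang (1990).
[cite: Zhang1990] -/
theorem hopTerm_commutator_etaLower (ε : Λ → ℤˣ) (x y : Λ) (σ : Fin 2) :
    etaLower ε * (creation (orb y σ) * annihilation (orb x σ)) -
        creation (orb y σ) * annihilation (orb x σ) * etaLower ε =
      ((ε y : ℤ) : ℂ) • (if σ = 0 then annihilation (orb y 1) * annihilation (orb x 0)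
        else -(annihilation (orb y 0) * annihilation (orb x 1))) := by
  have h := congrArg conjTranspose (hopTerm_commutator_etaRaise ε x y σ)
  have hstar : star (((ε y : ℤ) : ℂ)) = ((ε y : ℤ) : ℂ) := by simp
  fin_cases σ
  · simpa [conjTranspose_sub, conjTranspose_mul, conjTranspose_smul, etaLower,
      creation, hstar, Matrix.mul_assoc] using h
  · simpa [conjTranspose_sub, conjTranspose_mul, conjTranspose_smul, conjTranspose_neg, etaLower,
      creation, hstar, Matrix.mul_assoc] using h

/-- Spin-summed form: `η^- K_{yx} - K_{yx} η^- = -ε_y · d_{xy}` where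
`K_{yx} = Σ_σ c†_{yσ} c_{xσ}` and `d_{xy} = c_{x↑} c_{y↓} - c_{x↓} c_{y↑}`. Zhang (1990);
Markiewicz–Vaughn (1998) p. 3. [cite: Zhang1990] -/
theorem spinSummedHop_commutator_etaLower (ε : Λ → ℤˣ) (x y : Λ) :
    etaLower ε * (∑ σ : Fin 2, creation (orb y σ) * annihilation (orb x σ)) -
        (∑ σ : Fin 2, creation (orb y σ) * annihilation (orb x σ)) * etaLower ε =
      -(((ε y : ℤ) : ℂ) • bondPairAnn x y) := by
  have h0 := hopTerm_commutator_etaLower ε x y 0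
  have h1 := hopTerm_commutator_etaLower ε x y 1
  simp only [if_true] at h0
  simp only [Fin.one_eq_zero_iff, OfNat.ofNat_ne_one, if_false] at h1
  rw [Fin.sum_univ_two, mul_add, add_mul, add_sub_add_comm, h0, h1, ← smul_add, ← smul_neg,
    bondPairAnn, annihilation_mul_annihilation_eq_neg (orb y 1) (orb x 0),
    annihilation_mul_annihilation_eq_neg (orb y 0) (orb x 1)]
  congr 1
  abel

/-- The singlet bond pair is symmetric in the bond orientation: `d_{yx} = d_{xy}`. [folklore] -/
theorem bondPairAnn_symm (x y : Λ) : bondPairAnn y x = bondPairAnn x y := by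
  rw [bondPairAnn, bondPairAnn, annihilation_mul_annihilation_eq_neg (orb y 0) (orb x 1),
    annihilation_mul_annihilation_eq_neg (orb y 1) (orb x 0)]
  abel

/-- **Triplet lowering step** (Zhang 1990; Markiewicz–Vaughn 1998 p. 3): on a bond joining
opposite staggered signs, `ε_y = -ε_x`,
`η^- j_{xy} - j_{xy} η^- = -2 ε_x · d_{xy}`, i.e. the pseudospin lowering operator maps the
(staggered) bond current onto the singlet bond pair annihilator. [cite: Zhang1990] -/
theorem etaLower_commutator_bondCurrent (ε : Λ → ℤˣ) (x y : Λ) (hε : ε y = -ε x) :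
    etaLower ε * bondCurrent x y - bondCurrent x y * etaLower ε =
      (-(2 * ((ε x : ℤ) : ℂ))) • bondPairAnn x y := by
  have hxy := spinSummedHop_commutator_etaLower ε y x
  have hyx := spinSummedHop_commutator_etaLower ε x y
  rw [bondPairAnn_symm] at hxy
  have hsplit : etaLower ε * bondCurrent x y - bondCurrent x y * etaLower ε =
      (etaLower ε * (∑ σ : Fin 2, creation (orb x σ) * annihilation (orb y σ)) -
          (∑ σ : Fin 2, creation (orb x σ) * annihilation (orb y σ)) * etaLower ε) -
        (etaLower ε * (∑ σ : Fin 2, creation (orb y σ) * annihilation (orb x σ)) -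
          (∑ σ : Fin 2, creation (orb y σ) * annihilation (orb x σ)) * etaLower ε) := by
    simp only [bondCurrent, Finset.sum_sub_distrib, mul_sub, sub_mul]
    abel
  rw [hsplit, hxy, hyx, hε]
  push_cast
  simp only [neg_smul, neg_neg, mul_smul, two_smul, neg_add, sub_eq_add_neg]

/-- Products of two annihilators commute with products of two annihilators (four CAR swaps).
[folklore] -/
theorem annPair_mul_annPair_comm (a b p q : Orb Λ) :
    annihilation a * annihilation b * (annihilation p * annihilation q) =
      annihilation p * annihilation q * (annihilation a * annihilation b) := by
  have hbp := annihilation_mul_annihilation_eq_neg (Λ := Λ) b p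
  have hap := annihilation_mul_annihilation_eq_neg (Λ := Λ) a p
  have hbq := annihilation_mul_annihilation_eq_neg (Λ := Λ) b q
  have haq := annihilation_mul_annihilation_eq_neg (Λ := Λ) a q
  calc annihilation a * annihilation b * (annihilation p * annihilation q)
      = annihilation a * (annihilation b * annihilation p) * annihilation q := by noncomm_ring
    _ = -(annihilation a * annihilation p) * annihilation b * annihilation q := by
        rw [hbp]; noncomm_ring
    _ = annihilation p * annihilation a * (annihilation b * annihilation q) := by
        rw [hap]; noncomm_ring
    _ = -(annihilation p * (annihilation a * annihilation q) * annihilation b) := by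
        rw [hbq]; noncomm_ring
    _ = annihilation p * annihilation q * (annihilation a * annihilation b) := by
        rw [haq]; noncomm_ring

/-- `η_ε^- = Σ_z ε_z c_{z↓} c_{z↑}` (adjoint of `etaRaise`, termwise). Yang (1989) eq. (4).
[cite: Yang1989, eq. (4)] -/
theorem etaLower_eq_sum' (ε : Λ → ℤˣ) :
    etaLower ε = ∑ z, ((ε z : ℤ) : ℂ) • (annihilation (orb z 1) * annihilation (orb z 0)) := by
  simp [etaLower, etaRaise, conjTranspose_sum, conjTranspose_smul, conjTranspose_mul, creation]

/-- **Lowest component**: the singlet bond pair annihilator commutes with `η^-`,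
`[η_ε^-, d_{xy}] = 0` (both are built from annihilators only). Zhang (1990). [cite: Zhang1990] -/
theorem etaLower_commute_bondPairAnn (ε : Λ → ℤˣ) (x y : Λ) :
    Commute (etaLower ε) (bondPairAnn x y) := by
  rw [etaLower_eq_sum']
  refine Commute.sum_left _ _ _ fun z _ => Commute.smul_left ?_ _
  rw [bondPairAnn]
  refine Commute.sub_right ?_ ?_
  · exact (annPair_mul_annPair_comm (orb z 1) (orb z 0) (orb x 0) (orb y 1))
  · exact (annPair_mul_annPair_comm (orb z 1) (orb z 0) (orb x 1) (orb y 0))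

/-- **Zhang's triplet relation for a weighted bond family** (Zhang 1990; Markiewicz–Vaughn 1998
p. 3 for the `d`-wave weights): for bonds `b i = (x_i, y_i)` joining opposite staggered signs and
weights `w i`, `η^- J_w - J_w η^- = -2 · Δ_w` with `J_w = Σ_i (w_i ε_{x_i}) · j_{x_i y_i}` and
`Δ_w = Σ_i w_i · d_{x_i y_i}`. [cite: Zhang1990] -/
theorem etaLower_commutator_weightedCurrent {β : Type*} (s : Finset β) (b : β → Λ × Λ)
    (w : β → ℂ) (ε : Λ → ℤˣ) (hε : ∀ i ∈ s, ε (b i).2 = -ε (b i).1) :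
    etaLower ε * (∑ i ∈ s, (w i * ((ε (b i).1 : ℤ) : ℂ)) • bondCurrent (b i).1 (b i).2) -
        (∑ i ∈ s, (w i * ((ε (b i).1 : ℤ) : ℂ)) • bondCurrent (b i).1 (b i).2) * etaLower ε =
      (-2 : ℂ) • ∑ i ∈ s, w i • bondPairAnn (b i).1 (b i).2 := by
  rw [Finset.mul_sum, Finset.sum_mul, ← Finset.sum_sub_distrib, Finset.smul_sum]
  refine Finset.sum_congr rfl fun i hi => ?_
  rw [mul_smul_comm, smul_mul_assoc, ← smul_sub, etaLower_commutator_bondCurrent ε _ _ (hε i hi),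
    smul_smul, smul_smul]
  congr 1
  have h1 : ((ε (b i).1 : ℤ) : ℂ) * ((ε (b i).1 : ℤ) : ℂ) = 1 := by
    rw [← Int.cast_mul, ← Units.val_mul, Int.units_mul_self, Units.val_one, Int.cast_one]
  linear_combination (-2 * w i) * h1

/-- The weighted pair field is the lowest component: `[η^-, Δ_w] = 0`. [cite: Zhang1990] -/
theorem etaLower_commute_weightedPair {β : Type*} (s : Finset β) (b : β → Λ × Λ) (w : β → ℂ)
    (ε : Λ → ℤˣ) :
    Commute (etaLower ε) (∑ i ∈ s, w i • bondPairAnn (b i).1 (b i).2) :=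
  Commute.sum_right _ _ _ fun _ _ => Commute.smul_right (etaLower_commute_bondPairAnn ε _ _) _

end Hubbard

end Literature.MathematicalPhysics.QuantumLattice
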